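import Summits.AtomisticToContinuum.HydrodynamicLimit.Theses.InvariantGibbsBookkeeping
import Literature.Analysis.FluidPDE.HardSphereFlowJointMeasurable
import Literature.Analysis.FluidPDE.HardSphereFlowRegular
import Literature.Analysis.FluidPDE.CollisionalTransfer
import Literature.MathematicalPhysics.KineticTheory.HardSphereEulerProofs
import HarnessLib

/-!
# Line `kinetic-collisional-split` of the crux `EnergyFluxLocality` (stmt-AtomisticToContinuum-13369)

The TYPED DECOMPOSITION of the crux along the structure of the microscopic energy current
(crux-strategist, BC2 redirect of the RESTATED re-audit bin). By the weak energy balance law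
along the hard-sphere flow (Literature, PROVED: `HardSphereFlow.energyObservable_sub_eq_torus`)
the increment of the empirical energy field is EXACTLY `(N+1)⁻¹` times the time integral of the
streaming (kinetic) energy flux `energyStreaming χ` plus `(N+1)⁻¹` times the collisional energy
transfer `HardSphereFlow.energyTransfer χ`. The crux therefore splits into two channel laws on the
same GOOD events: the kinetic channel closes to the ideal enthalpy flux `(e + ρθ)u·∇χ` with zero
Euler-order heat flux (stub `stub_kineticEnergyFluxLocality` — the cubic-moment /
HighMomentumCutoff-carrying piece), and the collisional channel closes to the excess-pressure work
`(p − ρθ)u·∇χ = ρθ(Z(ρσ³) − 1)u·∇χ` (stub `stub_collisionalEnergyTransferLocality` — the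
contact-virial piece, sibling of the crux `CollisionalTransferLocality` stmt-9518). The
composition `EnergyFluxLocality_of` is a real proof: on the good event (coarse state in a compact
non-degenerate box) and inside the analyticity band of the hard-sphere equation of state (the
PROVED support `HsEosLowDensity`) the Euler energy flux of the coarse fields splits into its
kinetic and collisional parts AS BOCHNER INTEGRALS (`flux_split`: continuity in `x`, joint
measurability along the flow via `HardSphereFlow.measurable_flow_prod_torus`, uniform bounds on
the box), the increment is rewritten by the balance law on the flow's good set (a set of full
local-Gibbs measure, `localGibbsLaw_compl_good`), and the two channel laws are combined by a union
bound (`frame_of_two`). Axioms of `EnergyFluxLocality_of`: propext, Classical.choice, Quot.sound.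
-/

namespace Summit.AtomisticToContinuum.HydrodynamicLimit.Cruxes.EnergyFluxLocality.KineticCollisionalSplit

open scoped BigOperators Topology ENNReal InnerProductSpace
open Filter Set Function MeasureTheory
open Literature.MathematicalPhysics.KineticTheory Literature.Analysis.FluidPDE
open Literature.Analysis.FunctionSpaces (Torus.IsSmooth Torus.gradient)

noncomputable section

/-! ## Vocabulary (the crux's inlined `let`s as definitions) -/

/-- `(N+1)`-sphere phase space over `𝕋³`. -/
abbrev Cfg (n : ℕ) : Type := Config n (Fin 3) T3

/-- Families of hard-sphere flows at reduced density `σ`. -/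
abbrev Flows (σ : ℝ) : Type :=
  (N : ℕ) → HardSphereFlow (Torus.geometry (Fin 3)) (hsDiameter σ N) (N + 1)

variable {n : ℕ}

/-- `φ`-coarse-grained empirical density `ρ_φ(z)(x) = N⁻¹ ∑ᵢ φ(x − xᵢ)` (the crux's `ρK`). -/
def rhoK (φ : T3 → ℝ) (z : Cfg n) (x : T3) : ℝ := empiricalDensityField z (fun y => φ (x - y))

/-- `φ`-coarse-grained empirical momentum (the crux's `mK`). -/
def momK (φ : T3 → ℝ) (z : Cfg n) (x : T3) : V3 := empiricalMomentumField z (fun y => φ (x - y))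

/-- `φ`-coarse-grained empirical energy (the crux's `eK`). -/
def enK (φ : T3 → ℝ) (z : Cfg n) (x : T3) : ℝ := empiricalEnergyField z (fun y => φ (x - y))

/-- Temperature of a coarse state `(ρ, m, e)`: `θ = ⅔(e/ρ − |m|²/2ρ²)` (the crux's `θK`). -/
def thetaK (ρ : ℝ) (m : V3) (e : ℝ) : ℝ := 2 / 3 * (e / ρ - ‖m‖ ^ 2 / (2 * ρ ^ 2))

/-- The GOOD event of the flux cruxes: along `γ` on `[0, t]` the coarse state stays in the box
`λ ≤ ρ ≤ Λ`, `e ≤ M`, `θ ≥ λ` (the crux's `good`). -/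
def GoodEvt (φ : T3 → ℝ) (lam Λ M : ℝ) (γ : ℝ → Cfg n) (t : ℝ) : Prop :=
  ∀ τ ∈ Icc 0 t, ∀ x, lam ≤ rhoK φ (γ τ) x ∧ rhoK φ (γ τ) x ≤ Λ ∧ enK φ (γ τ) x ≤ M ∧
    lam ≤ thetaK (rhoK φ (γ τ) x) (momK φ (γ τ) x) (enK φ (γ τ) x)

/-- The hs-Euler energy flux `(e + p) u·g` of a coarse state (the crux's `enFlux`). -/
def enFlux (σ ρ : ℝ) (m : V3) (e : ℝ) (g : V3) : ℝ :=
  (e + hsPressure σ ρ (thetaK ρ m e)) / ρ * ⟪m, g⟫_ℝ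

/-- KINETIC part of the energy flux: the ideal enthalpy flux `(e + ρθ) u·g` (zero heat flux). -/
def kinFlux (ρ : ℝ) (m : V3) (e : ℝ) (g : V3) : ℝ :=
  (e + ρ * thetaK ρ m e) / ρ * ⟪m, g⟫_ℝ

/-- COLLISIONAL part of the energy flux: the excess-pressure work `(p − ρθ) u·g = θ(Z(ρσ³) − 1) m·g`. -/
def collFlux (σ ρ : ℝ) (m : V3) (e : ℝ) (g : V3) : ℝ :=
  (hsPressure σ ρ (thetaK ρ m e) - ρ * thetaK ρ m e) / ρ * ⟪m, g⟫_ℝ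

/-! ## The common frame of the flux cruxes and the deviations -/

/-- A deviation functional: `D σ Φ t χ lam Λ M φ N z`. -/
abbrev Dev : Type :=
  (σ : ℝ) → Flows σ → ℝ → (T3 → ℝ) → ℝ → ℝ → ℝ → (T3 → ℝ) → (N : ℕ) → Cfg (N + 1) → ℝ

/-- The common quantifier frame of `MomentumFluxLocality` / `EnergyFluxLocality` and of the pieces:
packing cap, profiles, small `σ`, a classical solution as clock, flows, LLN at time `0`, `t < T`,
smooth test, box parameters, tolerance `κ`, resolution `r`, kernels; conclusion: the local-Gibbs
probability of (GOOD ∧ `κ < |D|`) tends to `0`. -/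
def Frame (D : Dev) : Prop :=
  ∃ η₀ : ℝ, 0 < η₀ ∧ ∀ (a₀ θ₀ : T3 → ℝ) (u₀ : T3 → V3), Continuous a₀ → Continuous θ₀ → Continuous u₀ →
    (∀ x, 0 < a₀ x) → (∀ x, 0 < θ₀ x) → ∃ σ₀ : ℝ, 0 < σ₀ ∧ ∀ σ : ℝ, 0 < σ → σ < σ₀ →
    ∀ (T : ℝ) (ρ θ : ℝ → T3 → ℝ) (u : ℝ → T3 → V3), IsHardSphereEulerSolution σ T ρ u θ →
    ∀ Φ : Flows σ, TendstoHydroFieldsAt (fun N => localGibbsLaw σ a₀ u₀ θ₀ N (Φ N)) Φ ρ u θ 0 →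
    ∀ t ∈ Ico 0 T, ∀ χ : T3 → ℝ, Torus.IsSmooth χ → ∀ lam Λ M : ℝ, 0 < lam → Λ * σ ^ 3 ≤ η₀ →
    ∀ κ : ℝ, 0 < κ → ∃ r : ℝ, 0 < r ∧ ∀ φ : T3 → ℝ, Continuous φ → (∀ y, 0 ≤ φ y) → ∫ y, φ y = 1 →
    (∀ y, r ≤ ‖y‖ → φ y = 0) →
    Tendsto (fun N : ℕ => localGibbsLaw σ a₀ u₀ θ₀ N (Φ N)
      {z | GoodEvt φ lam Λ M (fun τ => (Φ N).flow τ z) t ∧ κ < |D σ Φ t χ lam Λ M φ N z|}) atTop (𝓝 0)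

/-- Deviation of the crux `EnergyFluxLocality`: energy increment minus the hs-Euler energy flux. -/
def devE : Dev := fun σ Φ t χ _ _ _ φ N z =>
  empiricalEnergyField ((Φ N).flow t z) χ - empiricalEnergyField ((Φ N).flow 0 z) χ -
    ∫ τ in Ioc 0 t, ∫ x, enFlux σ (rhoK φ ((Φ N).flow τ z) x) (momK φ ((Φ N).flow τ z) x)
      (enK φ ((Φ N).flow τ z) x) (Torus.gradient χ x)

/-- Deviation of the KINETIC channel: `(N+1)⁻¹ ∫₀ᵗ` (streaming energy flux
`Σᵢ (Dχ(xᵢ)vᵢ)|vᵢ|²/2`, Literature `energyStreaming`) minus the ideal enthalpy flux of the coarse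
fields. -/
def devK : Dev := fun _ Φ t χ _ _ _ φ N z =>
  ((N + 1 : ℕ) : ℝ)⁻¹ * (∫ τ in Ioc 0 t, energyStreaming χ ((Φ N).flow τ z)) -
    ∫ τ in Ioc 0 t, ∫ x, kinFlux (rhoK φ ((Φ N).flow τ z) x) (momK φ ((Φ N).flow τ z) x)
      (enK φ ((Φ N).flow τ z) x) (Torus.gradient χ x)

/-- Deviation of the COLLISIONAL channel: `(N+1)⁻¹ ×` the collisional energy transfer over
`(0, t]` tested against `χ` (Literature `HardSphereFlow.energyTransfer`: the sum over collision times
of the jumps of `Σᵢ χ(xᵢ)|vᵢ|²/2`) minus the excess-pressure work of the coarse fields. -/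
def devC : Dev := fun σ Φ t χ _ _ _ φ N z =>
  ((N + 1 : ℕ) : ℝ)⁻¹ * (Φ N).energyTransfer χ z t -
    ∫ τ in Ioc 0 t, ∫ x, collFlux σ (rhoK φ ((Φ N).flow τ z) x) (momK φ ((Φ N).flow τ z) x)
      (enK φ ((Φ N).flow τ z) x) (Torus.gradient χ x)

/-- The structured forms ARE the route decl / the pieces (δ/ζ/β-unfolding). -/
theorem frame_devE_iff :
    Frame devE ↔ Summit.AtomisticToContinuum.HydrodynamicLimit.Theses.InvariantGibbsBookkeeping.EnergyFluxLocality :=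
  Iff.rfl

/-- The structured kinetic-channel statement is VERBATIM the piece `KineticEnergyFluxLocality`. -/
theorem frame_devK_iff : Frame devK ↔ (let ρK : {n : ℕ} → (UnitAddTorus (Fin 3) → ℝ) → Literature.Analysis.FluidPDE.Config n (Fin 3) (UnitAddTorus (Fin 3)) → UnitAddTorus (Fin 3) → ℝ := fun φ z x => Literature.MathematicalPhysics.KineticTheory.empiricalDensityField z (fun y => φ (x - y)); let mK : {n : ℕ} → (UnitAddTorus (Fin 3) → ℝ) → Literature.Analysis.FluidPDE.Config n (Fin 3) (UnitAddTorus (Fin 3)) → UnitAddTorus (Fin 3) → EuclideanSpace ℝ (Fin 3) := fun φ z x => Literature.MathematicalPhysics.KineticTheory.empiricalMomentumField z (fun y => φ (x - y)); let eK : {n : ℕ} → (UnitAddTorus (Fin 3) → ℝ) → Literature.Analysis.FluidPDE.Config n (Fin 3) (UnitAddTorus (Fin 3)) → UnitAddTorus (Fin 3) → ℝ := fun φ z x => Literature.MathematicalPhysics.KineticTheory.empiricalEnergyField z (fun y => φ (x - y)); let θK : ℝ → EuclideanSpace ℝ (Fin 3) → ℝ → ℝ := fun ρ' m e => 2 / 3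 * (e / ρ' - ‖m‖ ^ 2 / (2 * ρ' ^ 2)); let good : {n : ℕ} → (UnitAddTorus (Fin 3) → ℝ) → ℝ → ℝ → ℝ → (ℝ → Literature.Analysis.FluidPDE.Config n (Fin 3) (UnitAddTorus (Fin 3))) → ℝ → Prop := fun φ lam Λ M γ t => ∀ τ ∈ Set.Icc 0 t, ∀ x, lam ≤ ρK φ (γ τ) x ∧ ρK φ (γ τ) x ≤ Λ ∧ eK φ (γ τ) x ≤ M ∧ lam ≤ θK (ρK φ (γ τ) x) (mK φ (γ τ) x) (eK φ (γ τ) x); let kinFlux : ℝ → EuclideanSpace ℝ (Fin 3) → ℝ → EuclideanSpace ℝ (Fin 3) → ℝ := fun ρ' m e g => (e + ρ' * θK ρ' m e) / ρ' * inner ℝ m g; ∃ η₀ : ℝ, 0 < η₀ ∧ ∀ (a₀ θ₀ : UnitAddTorus (Fin 3) → ℝ) (u₀ : UnitAddTorus (Fin 3) → EuclideanSpace ℝ (Fin 3)), Continuous a₀ → Continuous θ₀ → Continuous u₀ → (∀ x, 0 < a₀ x) → (∀ x, 0 < θ₀ x) → ∃ σ₀ : ℝ, 0 < σ₀ ∧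 ∀ σ : ℝ, 0 < σ → σ < σ₀ → ∀ (T : ℝ) (ρ θ : ℝ → UnitAddTorus (Fin 3) → ℝ) (u : ℝ → UnitAddTorus (Fin 3) → EuclideanSpace ℝ (Fin 3)), Literature.MathematicalPhysics.KineticTheory.IsHardSphereEulerSolution σ T ρ u θ → ∀ Φ : (N : ℕ) → Literature.Analysis.FluidPDE.HardSphereFlow (Literature.Analysis.FluidPDE.Torus.geometry (Fin 3)) (Literature.MathematicalPhysics.KineticTheory.hsDiameter σ N) (N + 1), Literature.MathematicalPhysics.KineticTheory.TendstoHydroFieldsAt (fun N => Literature.MathematicalPhysics.KineticTheory.localGibbsLaw σ a₀ u₀ θ₀ N (Φ N)) Φ ρ u θ 0 → ∀ t ∈ Set.Ico 0 T, ∀ χ : UnitAddTorus (Fin 3) → ℝ, Literature.Analysis.FunctionSpaces.Torus.IsSmooth χ → ∀ lam Λ M : ℝ, 0 < lam → Λ * σ ^ 3 ≤ η₀ → ∀ κ : ℝ, 0 < κ → ∃ r : ℝ, 0 < r ∧ ∀ φ : UnitAddTorus (Fin 3) → ℝ, Continuous φ → (∀ y, 0 ≤ φ y) → ∫ y, φ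 y = 1 → (∀ y, r ≤ ‖y‖ → φ y = 0) → Filter.Tendsto (fun N : ℕ => Literature.MathematicalPhysics.KineticTheory.localGibbsLaw σ a₀ u₀ θ₀ N (Φ N) {z | good φ lam Λ M (fun τ => (Φ N).flow τ z) t ∧ κ < |((N + 1 : ℕ) : ℝ)⁻¹ * (∫ τ in Set.Ioc 0 t, Literature.Analysis.FluidPDE.energyStreaming χ ((Φ N).flow τ z)) - ∫ τ in Set.Ioc 0 t, ∫ x, kinFlux (ρK φ ((Φ N).flow τ z) x) (mK φ ((Φ N).flow τ z) x) (eK φ ((Φ N).flow τ z) x) (Literature.Analysis.FunctionSpaces.Torus.gradient χ x)|}) Filter.atTop (nhds 0)) :=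
  Iff.rfl

/-- The structured collisional-channel statement is VERBATIM the piece `CollisionalEnergyTransferLocality`. -/
theorem frame_devC_iff : Frame devC ↔ (let ρK : {n : ℕ} → (UnitAddTorus (Fin 3) → ℝ) → Literature.Analysis.FluidPDE.Config n (Fin 3) (UnitAddTorus (Fin 3)) → UnitAddTorus (Fin 3) → ℝ := fun φ z x => Literature.MathematicalPhysics.KineticTheory.empiricalDensityField z (fun y => φ (x - y)); let mK : {n : ℕ} → (UnitAddTorus (Fin 3) → ℝ) → Literature.Analysis.FluidPDE.Config n (Fin 3) (UnitAddTorus (Fin 3)) → UnitAddTorus (Fin 3) → EuclideanSpace ℝ (Fin 3) := fun φ z x => Literature.MathematicalPhysics.KineticTheory.empiricalMomentumField z (fun y => φ (x - y)); let eK : {n : ℕ} → (UnitAddTorus (Fin 3) → ℝ) → Literature.Analysis.FluidPDE.Config n (Fin 3) (UnitAddTorus (Fin 3)) → UnitAddTorus (Fin 3) → ℝ := fun φ z x => Literature.MathematicalPhysics.KineticTheory.empiricalEnergyField z (fun y => φ (x - y)); let θK : ℝ → EuclideanSpace ℝ (Fin 3) → ℝ → ℝ := fun ρ' m e => 2 /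 3 * (e / ρ' - ‖m‖ ^ 2 / (2 * ρ' ^ 2)); let good : {n : ℕ} → (UnitAddTorus (Fin 3) → ℝ) → ℝ → ℝ → ℝ → (ℝ → Literature.Analysis.FluidPDE.Config n (Fin 3) (UnitAddTorus (Fin 3))) → ℝ → Prop := fun φ lam Λ M γ t => ∀ τ ∈ Set.Icc 0 t, ∀ x, lam ≤ ρK φ (γ τ) x ∧ ρK φ (γ τ) x ≤ Λ ∧ eK φ (γ τ) x ≤ M ∧ lam ≤ θK (ρK φ (γ τ) x) (mK φ (γ τ) x) (eK φ (γ τ) x); let collFlux : ℝ → ℝ → EuclideanSpace ℝ (Fin 3) → ℝ → EuclideanSpace ℝ (Fin 3) → ℝ := fun σ' ρ' m e g => (Literature.MathematicalPhysics.KineticTheory.hsPressure σ' ρ' (θK ρ' m e) - ρ' * θK ρ' m e) / ρ' * inner ℝ m g; ∃ η₀ : ℝ, 0 < η₀ ∧ ∀ (a₀ θ₀ : UnitAddTorus (Fin 3) → ℝ) (u₀ : UnitAddTorus (Fin 3) → EuclideanSpace ℝ (Fin 3)), Continuous a₀ → Continuous θ₀ → Continuous u₀ → (∀ x, 0 < a₀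 x) → (∀ x, 0 < θ₀ x) → ∃ σ₀ : ℝ, 0 < σ₀ ∧ ∀ σ : ℝ, 0 < σ → σ < σ₀ → ∀ (T : ℝ) (ρ θ : ℝ → UnitAddTorus (Fin 3) → ℝ) (u : ℝ → UnitAddTorus (Fin 3) → EuclideanSpace ℝ (Fin 3)), Literature.MathematicalPhysics.KineticTheory.IsHardSphereEulerSolution σ T ρ u θ → ∀ Φ : (N : ℕ) → Literature.Analysis.FluidPDE.HardSphereFlow (Literature.Analysis.FluidPDE.Torus.geometry (Fin 3)) (Literature.MathematicalPhysics.KineticTheory.hsDiameter σ N) (N + 1), Literature.MathematicalPhysics.KineticTheory.TendstoHydroFieldsAt (fun N => Literature.MathematicalPhysics.KineticTheory.localGibbsLaw σ a₀ u₀ θ₀ N (Φ N)) Φ ρ u θ 0 → ∀ t ∈ Set.Ico 0 T, ∀ χ : UnitAddTorus (Fin 3) → ℝ, Literature.Analysis.FunctionSpaces.Torus.IsSmooth χ → ∀ lam Λ M : ℝ, 0 < lam → Λ * σ ^ 3 ≤ η₀ → ∀ κ : ℝ, 0 < κ → ∃ r : ℝ, 0 < r ∧ ∀ φ : UnitAddTorus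 (Fin 3) → ℝ, Continuous φ → (∀ y, 0 ≤ φ y) → ∫ y, φ y = 1 → (∀ y, r ≤ ‖y‖ → φ y = 0) → Filter.Tendsto (fun N : ℕ => Literature.MathematicalPhysics.KineticTheory.localGibbsLaw σ a₀ u₀ θ₀ N (Φ N) {z | good φ lam Λ M (fun τ => (Φ N).flow τ z) t ∧ κ < |((N + 1 : ℕ) : ℝ)⁻¹ * Literature.Analysis.FluidPDE.HardSphereFlow.energyTransfer (Φ N) χ z t - ∫ τ in Set.Ioc 0 t, ∫ x, collFlux σ (ρK φ ((Φ N).flow τ z) x) (mK φ ((Φ N).flow τ z) x) (eK φ ((Φ N).flow τ z) x) (Literature.Analysis.FunctionSpaces.Torus.gradient χ x)|}) Filter.atTop (nhds 0)) :=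
  Iff.rfl

/-! ## The two registered stubs (the pieces, verbatim; `Holds.stub_*`, bodies `sorry`) -/

namespace Holds

/-- STUB (crux piece): KINETIC ENERGY-FLUX LOCALITY on good events, pre-shock — the time-integrated
streaming energy flux is the ideal enthalpy flux `(e + ρθ)u·∇χ` of the coarse state (zero
Euler-order kinetic heat flux); a cubic velocity moment (HighMomentumCutoff-carrying). -/
theorem stub_kineticEnergyFluxLocality : let ρK : {n : ℕ} → (UnitAddTorus (Fin 3) → ℝ) → Literature.Analysis.FluidPDE.Config n (Fin 3) (UnitAddTorus (Fin 3)) → UnitAddTorus (Fin 3) → ℝ := fun φ z x => Literature.MathematicalPhysics.KineticTheory.empiricalDensityField z (fun y => φ (x - y)); let mK : {n : ℕ} → (UnitAddTorus (Fin 3) → ℝ) → Literature.Analysis.FluidPDE.Config n (Fin 3) (UnitAddTorus (Fin 3)) → UnitAddTorus (Fin 3) → EuclideanSpace ℝ (Fin 3) := fun φ z x => Literature.MathematicalPhysics.KineticTheory.empiricalMomentumField z (fun y => φ (x - y)); let eK : {n : ℕ} → (UnitAddTorus (Fin 3) → ℝ) → Literature.Analysis.FluidPDE.Config n (Fin 3)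 (UnitAddTorus (Fin 3)) → UnitAddTorus (Fin 3) → ℝ := fun φ z x => Literature.MathematicalPhysics.KineticTheory.empiricalEnergyField z (fun y => φ (x - y)); let θK : ℝ → EuclideanSpace ℝ (Fin 3) → ℝ → ℝ := fun ρ' m e => 2 / 3 * (e / ρ' - ‖m‖ ^ 2 / (2 * ρ' ^ 2)); let good : {n : ℕ} → (UnitAddTorus (Fin 3) → ℝ) → ℝ → ℝ → ℝ → (ℝ → Literature.Analysis.FluidPDE.Config n (Fin 3) (UnitAddTorus (Fin 3))) → ℝ → Prop := fun φ lam Λ M γ t => ∀ τ ∈ Set.Icc 0 t, ∀ x, lam ≤ ρK φ (γ τ) x ∧ ρK φ (γ τ) x ≤ Λ ∧ eK φ (γ τ) x ≤ M ∧ lam ≤ θK (ρK φ (γ τ) x) (mK φ (γ τ) x) (eK φ (γ τ) x); let kinFlux : ℝ → EuclideanSpace ℝ (Fin 3) → ℝ → EuclideanSpace ℝ (Fin 3) → ℝ := fun ρ' m e g => (e + ρ' * θK ρ' m e) / ρ' * inner ℝ m g; ∃ η₀ : ℝ, 0 < η₀ ∧ ∀ (a₀ θ₀ : UnitAddTorus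 (Fin 3) → ℝ) (u₀ : UnitAddTorus (Fin 3) → EuclideanSpace ℝ (Fin 3)), Continuous a₀ → Continuous θ₀ → Continuous u₀ → (∀ x, 0 < a₀ x) → (∀ x, 0 < θ₀ x) → ∃ σ₀ : ℝ, 0 < σ₀ ∧ ∀ σ : ℝ, 0 < σ → σ < σ₀ → ∀ (T : ℝ) (ρ θ : ℝ → UnitAddTorus (Fin 3) → ℝ) (u : ℝ → UnitAddTorus (Fin 3) → EuclideanSpace ℝ (Fin 3)), Literature.MathematicalPhysics.KineticTheory.IsHardSphereEulerSolution σ T ρ u θ → ∀ Φ : (N : ℕ) → Literature.Analysis.FluidPDE.HardSphereFlow (Literature.Analysis.FluidPDE.Torus.geometry (Fin 3)) (Literature.MathematicalPhysics.KineticTheory.hsDiameter σ N) (N + 1), Literature.MathematicalPhysics.KineticTheory.TendstoHydroFieldsAt (fun N => Literature.MathematicalPhysics.KineticTheory.localGibbsLaw σ a₀ u₀ θ₀ N (Φ N)) Φ ρ u θ 0 → ∀ t ∈ Set.Ico 0 T, ∀ χ : UnitAddTorus (Fin 3) → ℝ, Literature.Analysis.FunctionSpaces.Torus.IsSmooth χ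 → ∀ lam Λ M : ℝ, 0 < lam → Λ * σ ^ 3 ≤ η₀ → ∀ κ : ℝ, 0 < κ → ∃ r : ℝ, 0 < r ∧ ∀ φ : UnitAddTorus (Fin 3) → ℝ, Continuous φ → (∀ y, 0 ≤ φ y) → ∫ y, φ y = 1 → (∀ y, r ≤ ‖y‖ → φ y = 0) → Filter.Tendsto (fun N : ℕ => Literature.MathematicalPhysics.KineticTheory.localGibbsLaw σ a₀ u₀ θ₀ N (Φ N) {z | good φ lam Λ M (fun τ => (Φ N).flow τ z) t ∧ κ < |((N + 1 : ℕ) : ℝ)⁻¹ * (∫ τ in Set.Ioc 0 t, Literature.Analysis.FluidPDE.energyStreaming χ ((Φ N).flow τ z)) - ∫ τ in Set.Ioc 0 t, ∫ x, kinFlux (ρK φ ((Φ N).flow τ z) x) (mK φ ((Φ N).flow τ z) x) (eK φ ((Φ N).flow τ z) x) (Literature.Analysis.FunctionSpaces.Torus.gradient χ x)|}) Filter.atTop (nhds 0) := by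
  sorry

/-- STUB (crux piece): COLLISIONAL ENERGY-TRANSFER LOCALITY on good events, pre-shock — the
collisional energy transfer is the excess-pressure work `(p − ρθ)u·∇χ = ρθ(Z(ρσ³) − 1)u·∇χ` of the
coarse state (contact virial; zero Euler-order collisional heat flux). -/
theorem stub_collisionalEnergyTransferLocality : let ρK : {n : ℕ} → (UnitAddTorus (Fin 3) → ℝ) → Literature.Analysis.FluidPDE.Config n (Fin 3) (UnitAddTorus (Fin 3)) → UnitAddTorus (Fin 3) → ℝ := fun φ z x => Literature.MathematicalPhysics.KineticTheory.empiricalDensityField z (fun y => φ (x - y)); let mK : {n : ℕ} → (UnitAddTorus (Fin 3) → ℝ) → Literature.Analysis.FluidPDE.Config n (Fin 3) (UnitAddTorus (Fin 3)) → UnitAddTorus (Fin 3) → EuclideanSpace ℝ (Fin 3) := fun φ z x => Literature.MathematicalPhysics.KineticTheory.empiricalMomentumField z (fun y => φ (x - y)); let eK : {n : ℕ} → (UnitAddTorus (Fin 3) → ℝ) → Literature.Analysis.FluidPDE.Config n (Fin 3) (UnitAddTorus (Fin 3)) → UnitAddTorus (Fin 3) → ℝ := fun φ z x => Literature.MathematicalPhysics.KineticTheory.empiricalEnergyField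 z (fun y => φ (x - y)); let θK : ℝ → EuclideanSpace ℝ (Fin 3) → ℝ → ℝ := fun ρ' m e => 2 / 3 * (e / ρ' - ‖m‖ ^ 2 / (2 * ρ' ^ 2)); let good : {n : ℕ} → (UnitAddTorus (Fin 3) → ℝ) → ℝ → ℝ → ℝ → (ℝ → Literature.Analysis.FluidPDE.Config n (Fin 3) (UnitAddTorus (Fin 3))) → ℝ → Prop := fun φ lam Λ M γ t => ∀ τ ∈ Set.Icc 0 t, ∀ x, lam ≤ ρK φ (γ τ) x ∧ ρK φ (γ τ) x ≤ Λ ∧ eK φ (γ τ) x ≤ M ∧ lam ≤ θK (ρK φ (γ τ) x) (mK φ (γ τ) x) (eK φ (γ τ) x); let collFlux : ℝ → ℝ → EuclideanSpace ℝ (Fin 3) → ℝ → EuclideanSpace ℝ (Fin 3) → ℝ := fun σ' ρ' m e g => (Literature.MathematicalPhysics.KineticTheory.hsPressure σ' ρ' (θK ρ' m e) - ρ' * θK ρ' m e) / ρ' * inner ℝ m g; ∃ η₀ : ℝ, 0 < η₀ ∧ ∀ (a₀ θ₀ : UnitAddTorus (Fin 3) → ℝ) (u₀ : UnitAddTorus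 (Fin 3) → EuclideanSpace ℝ (Fin 3)), Continuous a₀ → Continuous θ₀ → Continuous u₀ → (∀ x, 0 < a₀ x) → (∀ x, 0 < θ₀ x) → ∃ σ₀ : ℝ, 0 < σ₀ ∧ ∀ σ : ℝ, 0 < σ → σ < σ₀ → ∀ (T : ℝ) (ρ θ : ℝ → UnitAddTorus (Fin 3) → ℝ) (u : ℝ → UnitAddTorus (Fin 3) → EuclideanSpace ℝ (Fin 3)), Literature.MathematicalPhysics.KineticTheory.IsHardSphereEulerSolution σ T ρ u θ → ∀ Φ : (N : ℕ) → Literature.Analysis.FluidPDE.HardSphereFlow (Literature.Analysis.FluidPDE.Torus.geometry (Fin 3)) (Literature.MathematicalPhysics.KineticTheory.hsDiameter σ N) (N + 1), Literature.MathematicalPhysics.KineticTheory.TendstoHydroFieldsAt (fun N => Literature.MathematicalPhysics.KineticTheory.localGibbsLaw σ a₀ u₀ θ₀ N (Φ N)) Φ ρ u θ 0 → ∀ t ∈ Set.Ico 0 T, ∀ χ : UnitAddTorus (Fin 3) → ℝ, Literature.Analysis.FunctionSpaces.Torus.IsSmooth χ → ∀ lam Λ M : ℝ, 0 < lam → Λ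 * σ ^ 3 ≤ η₀ → ∀ κ : ℝ, 0 < κ → ∃ r : ℝ, 0 < r ∧ ∀ φ : UnitAddTorus (Fin 3) → ℝ, Continuous φ → (∀ y, 0 ≤ φ y) → ∫ y, φ y = 1 → (∀ y, r ≤ ‖y‖ → φ y = 0) → Filter.Tendsto (fun N : ℕ => Literature.MathematicalPhysics.KineticTheory.localGibbsLaw σ a₀ u₀ θ₀ N (Φ N) {z | good φ lam Λ M (fun τ => (Φ N).flow τ z) t ∧ κ < |((N + 1 : ℕ) : ℝ)⁻¹ * Literature.Analysis.FluidPDE.HardSphereFlow.energyTransfer (Φ N) χ z t - ∫ τ in Set.Ioc 0 t, ∫ x, collFlux σ (ρK φ ((Φ N).flow τ z) x) (mK φ ((Φ N).flow τ z) x) (eK φ ((Φ N).flow τ z) x) (Literature.Analysis.FunctionSpaces.Torus.gradient χ x)|}) Filter.atTop (nhds 0) := by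
  sorry

end Holds

/-! ## Stub statements by name (D-0027 §3.3: the hypotheses of `_of` are these `Prop`s) -/

/-- Statement of registered stub 1 (`Holds.stub_kineticEnergyFluxLocality`), by name: verbatim the
child statement `KineticEnergyFluxLocality`. -/
def stub_kineticEnergyFluxLocality : Prop := type_of% Holds.stub_kineticEnergyFluxLocality

/-- Statement of registered stub 2 (`Holds.stub_collisionalEnergyTransferLocality`), by name:
verbatim the child statement `CollisionalEnergyTransferLocality`. -/
def stub_collisionalEnergyTransferLocality : Prop :=
  type_of% Holds.stub_collisionalEnergyTransferLocality

/-! ## Algebra of the flux split and of the coarse fields -/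

/-- The Euler energy flux is the kinetic part plus the collisional part (pointwise, no side
condition: `(e + p)/ρ = (e + ρθ)/ρ + (p − ρθ)/ρ`). -/
theorem enFlux_eq_kinFlux_add_collFlux (σ ρ : ℝ) (m : V3) (e : ℝ) (g : V3) :
    enFlux σ ρ m e g = kinFlux ρ m e g + collFlux σ ρ m e g := by
  simp only [enFlux, kinFlux, collFlux]
  rw [← add_mul, ← add_div]
  ring_nf

/-- The coarse density as a finite average. -/
theorem rhoK_eq (φ : T3 → ℝ) (z : Cfg n) (x : T3) :
    rhoK φ z x = (n : ℝ)⁻¹ * ∑ i, φ (x - (z i).1) :=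
  empiricalDensityField_eq_sum z _

/-- The coarse momentum as a finite average. -/
theorem momK_eq (φ : T3 → ℝ) (z : Cfg n) (x : T3) :
    momK φ z x = (n : ℝ)⁻¹ • ∑ i, φ (x - (z i).1) • (z i).2 :=
  empiricalMomentumField_eq_sum z _

/-- The coarse energy as a finite average. -/
theorem enK_eq (φ : T3 → ℝ) (z : Cfg n) (x : T3) :
    enK φ z x = (n : ℝ)⁻¹ * ∑ i, φ (x - (z i).1) * (‖(z i).2‖ ^ 2 / 2) :=
  empiricalEnergyField_eq_sum z _

/-- Joint continuity of the coarse density in (configuration, point). -/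
theorem continuous_rhoK {φ : T3 → ℝ} (hφ : Continuous φ) :
    Continuous fun p : Cfg n × T3 => rhoK φ p.1 p.2 := by
  simp only [rhoK_eq]
  refine continuous_const.mul (continuous_finsetSum _ fun i _ => ?_)
  exact hφ.comp (continuous_snd.sub ((continuous_apply i).comp continuous_fst).fst)

/-- Joint continuity of the coarse momentum in (configuration, point). -/
theorem continuous_momK {φ : T3 → ℝ} (hφ : Continuous φ) :
    Continuous fun p : Cfg n × T3 => momK φ p.1 p.2 := by
  simp only [momK_eq]
  have hsum : Continuous fun p : Cfg n × T3 => ∑ i, φ (p.2 - (p.1 i).1) • (p.1 i).2 :=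
    continuous_finsetSum _ fun i _ =>
      (hφ.comp (continuous_snd.sub ((continuous_apply i).comp continuous_fst).fst)).smul
        ((continuous_apply i).comp continuous_fst).snd
  exact hsum.const_smul ((n : ℝ)⁻¹)

/-- Joint continuity of the coarse energy in (configuration, point). -/
theorem continuous_enK {φ : T3 → ℝ} (hφ : Continuous φ) :
    Continuous fun p : Cfg n × T3 => enK φ p.1 p.2 := by
  simp only [enK_eq]
  refine continuous_const.mul (continuous_finsetSum _ fun i _ => ?_)
  exact (hφ.comp (continuous_snd.sub ((continuous_apply i).comp continuous_fst).fst)).mul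
    ((((continuous_apply i).comp continuous_fst).snd.norm.pow 2).div_const 2)

/-! ## Measurability of the flux integrands -/

/-- The compressibility factor `Z(η) = 1 + η f_ex′(η)` is Borel measurable (a `deriv` is). -/
theorem measurable_hsCompressibility : Measurable hsCompressibility := by
  unfold hsCompressibility
  exact measurable_const.add (measurable_id.mul (measurable_deriv _))

/-- Measurability of the temperature of a measurably varying coarse state. -/
theorem measurable_thetaK {α : Type*} [MeasurableSpace α] {ρ e : α → ℝ} {m : α → V3}
    (hρ : Measurable ρ) (hm : Measurable m) (he : Measurable e) :
    Measurable fun a => thetaK (ρ a) (m a) (e a) := by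
  unfold thetaK
  exact ((he.div hρ).sub ((hm.norm.pow_const 2).div (hρ.pow_const 2 |>.const_mul 2))).const_mul _

/-- Measurability of the kinetic flux of a measurably varying coarse state. -/
theorem measurable_kinFlux {α : Type*} [MeasurableSpace α] {ρ e : α → ℝ} {m g : α → V3}
    (hρ : Measurable ρ) (hm : Measurable m) (he : Measurable e) (hg : Measurable g) :
    Measurable fun a => kinFlux (ρ a) (m a) (e a) (g a) := by
  unfold kinFlux
  exact ((he.add (hρ.mul (measurable_thetaK hρ hm he))).div hρ).mul (hm.inner hg)

/-- Measurability of the collisional flux of a measurably varying coarse state. -/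
theorem measurable_collFlux {α : Type*} [MeasurableSpace α] (σ : ℝ) {ρ e : α → ℝ} {m g : α → V3}
    (hρ : Measurable ρ) (hm : Measurable m) (he : Measurable e) (hg : Measurable g) :
    Measurable fun a => collFlux σ (ρ a) (m a) (e a) (g a) := by
  unfold collFlux hsPressure
  have hθ := measurable_thetaK hρ hm he
  have hZ : Measurable fun a => hsCompressibility (ρ a * σ ^ 3) :=
    measurable_hsCompressibility.comp (hρ.mul_const _)
  exact ((((hρ.mul hθ).mul hZ).sub (hρ.mul hθ)).div hρ).mul (hm.inner hg)

/-- On `𝕋³ × (phase space)`-type products, measurability of the kinetic-flux integrand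
`(z, x) ↦ kinFlux(ρ_φ(z)(x), m_φ(z)(x), e_φ(z)(x), ∇χ(x))`. -/
theorem measurable_kinIntegrand {φ : T3 → ℝ} (hφ : Continuous φ) {g : T3 → V3} (hg : Continuous g) :
    Measurable fun p : Cfg n × T3 => kinFlux (rhoK φ p.1 p.2) (momK φ p.1 p.2) (enK φ p.1 p.2) (g p.2) :=
  measurable_kinFlux (continuous_rhoK hφ).measurable (continuous_momK hφ).measurable
    (continuous_enK hφ).measurable (hg.comp continuous_snd).measurable

/-- Measurability of the collisional-flux integrand on the product. -/
theorem measurable_collIntegrand (σ : ℝ) {φ : T3 → ℝ} (hφ : Continuous φ) {g : T3 → V3}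
    (hg : Continuous g) :
    Measurable fun p : Cfg n × T3 =>
      collFlux σ (rhoK φ p.1 p.2) (momK φ p.1 p.2) (enK φ p.1 p.2) (g p.2) :=
  measurable_collFlux σ (continuous_rhoK hφ).measurable (continuous_momK hφ).measurable
    (continuous_enK hφ).measurable (hg.comp continuous_snd).measurable

/-- A measurable integrand on the product integrates (in the point) to a measurable function of
the configuration (Fubini measurability). -/
theorem measurable_integral_right {F : Cfg n × T3 → ℝ} (hF : Measurable F) :
    Measurable fun w : Cfg n => ∫ x, F (w, x) :=
  (hF.stronglyMeasurable.integral_prod_right').measurable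

/-- Good orbits are measurable in time (joint measurability of the flow on `good × ℝ`). -/
theorem measurable_orbit {ε : ℝ} (Φ : HardSphereFlow (Torus.geometry (Fin 3)) ε n) {z : Cfg n}
    (hz : z ∈ Φ.good) : Measurable fun τ : ℝ => Φ.flow τ z :=
  (Φ.measurable_flow_prod_torus).comp
    ((measurable_const : Measurable fun _ : ℝ => (⟨z, hz⟩ : Φ.good)).prodMk measurable_id)

/-! ## The good box: elementary consequences -/

/-- On the good box `λ ≤ ρ ≤ Λ`, `e ≤ M`, `θ ≥ λ > 0`: the density is positive, the energy is
nonnegative, the momentum is bounded (`|m|² ≤ 2ΛM`, from `θ > 0`), the internal energy `ρθ` lies in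
`[0, M]` and `θ ≤ M/λ`. -/
theorem box_est {lam Λ M ρ e : ℝ} {m : V3} (hlam : 0 < lam) (h1 : lam ≤ ρ) (h2 : ρ ≤ Λ) (h3 : e ≤ M)
    (h4 : lam ≤ thetaK ρ m e) :
    0 < ρ ∧ 0 ≤ e ∧ ‖m‖ ^ 2 ≤ 2 * Λ * M ∧ 0 ≤ ρ * thetaK ρ m e ∧ ρ * thetaK ρ m e ≤ M ∧
      thetaK ρ m e ≤ M / lam := by
  have hρ : 0 < ρ := hlam.trans_le h1
  have hθ : 0 < thetaK ρ m e := hlam.trans_le h4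
  have hρθ : ρ * thetaK ρ m e = 2 / 3 * (e - ‖m‖ ^ 2 / (2 * ρ)) := by
    unfold thetaK
    field_simp
  have hρθpos : 0 < ρ * thetaK ρ m e := mul_pos hρ hθ
  have hm0 : 0 ≤ ‖m‖ ^ 2 / (2 * ρ) := by positivity
  have he : 0 < e := by nlinarith [hρθpos, hρθ, hm0]
  have hm2 : ‖m‖ ^ 2 ≤ 2 * ρ * e := by
    have hlt : ‖m‖ ^ 2 / (2 * ρ) < e := by nlinarith [hρθpos, hρθ]
    have := (div_lt_iff₀ (by positivity : (0 : ℝ) < 2 * ρ)).1 hlt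
    nlinarith [this]
  have hm3 : 2 * ρ * e ≤ 2 * Λ * M := by
    have := mul_le_mul h2 h3 he.le (hρ.le.trans h2)
    nlinarith [this]
  have hρθM : ρ * thetaK ρ m e ≤ M := by nlinarith [hρθ, hm0, h3]
  refine ⟨hρ, he.le, hm2.trans hm3, hρθpos.le, hρθM, ?_⟩
  rw [le_div_iff₀ hlam]
  calc thetaK ρ m e * lam ≤ thetaK ρ m e * ρ := mul_le_mul_of_nonneg_left h1 hθ.le
    _ = ρ * thetaK ρ m e := mul_comm _ _
    _ ≤ M := hρθM

/-- Pointwise bound for the kinetic flux on the good box: `|kinFlux| ≤ (2M/λ)·√(2ΛM)·G`. -/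
theorem abs_kinFlux_le {lam Λ M G ρ e : ℝ} {m g : V3} (hlam : 0 < lam) (h1 : lam ≤ ρ) (h2 : ρ ≤ Λ)
    (h3 : e ≤ M) (h4 : lam ≤ thetaK ρ m e) (hg : ‖g‖ ≤ G) :
    |kinFlux ρ m e g| ≤ 2 * M / lam * (Real.sqrt (2 * Λ * M) * G) := by
  obtain ⟨hρ, he, hm2, hρθ0, hρθM, -⟩ := box_est hlam h1 h2 h3 h4
  have hM : 0 ≤ M := he.trans h3
  have hnum : |e + ρ * thetaK ρ m e| ≤ 2 * M := by
    rw [abs_of_nonneg (by linarith)]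
    linarith
  have hfac : |(e + ρ * thetaK ρ m e) / ρ| ≤ 2 * M / lam := by
    rw [abs_div, abs_of_pos hρ]
    calc |e + ρ * thetaK ρ m e| / ρ ≤ 2 * M / ρ := by gcongr
      _ ≤ 2 * M / lam := by gcongr
  have hm : ‖m‖ ≤ Real.sqrt (2 * Λ * M) := by
    simpa [abs_of_nonneg (norm_nonneg m)] using Real.abs_le_sqrt hm2
  have hinner : |⟪m, g⟫_ℝ| ≤ Real.sqrt (2 * Λ * M) * G :=
    (abs_real_inner_le_norm m g).trans (mul_le_mul hm hg (norm_nonneg _) (Real.sqrt_nonneg _))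
  unfold kinFlux
  rw [abs_mul]
  exact mul_le_mul hfac hinner (abs_nonneg _) (by positivity)

/-- Pointwise bound for the collisional flux on the good box, given a bound `CZ` on `|Z(ρσ³) − 1|`
there: `|collFlux| ≤ (M/λ)·CZ·√(2ΛM)·G`. -/
theorem abs_collFlux_le {σ lam Λ M G CZ ρ e : ℝ} {m g : V3} (hlam : 0 < lam) (h1 : lam ≤ ρ)
    (h2 : ρ ≤ Λ) (h3 : e ≤ M) (h4 : lam ≤ thetaK ρ m e) (hg : ‖g‖ ≤ G)
    (hZ : |hsCompressibility (ρ * σ ^ 3) - 1| ≤ CZ) :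
    |collFlux σ ρ m e g| ≤ M / lam * CZ * (Real.sqrt (2 * Λ * M) * G) := by
  obtain ⟨hρ, he, hm2, hρθ0, hρθM, hθM⟩ := box_est hlam h1 h2 h3 h4
  have hθ : 0 < thetaK ρ m e := hlam.trans_le h4
  have hM : 0 ≤ M := he.trans h3
  have hCZ : 0 ≤ CZ := (abs_nonneg _).trans hZ
  have hfac : |(hsPressure σ ρ (thetaK ρ m e) - ρ * thetaK ρ m e) / ρ| ≤ M / lam * CZ := by
    have hrw : (hsPressure σ ρ (thetaK ρ m e) - ρ * thetaK ρ m e) / ρ =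
        thetaK ρ m e * (hsCompressibility (ρ * σ ^ 3) - 1) := by
      unfold hsPressure
      field_simp
    rw [hrw, abs_mul, abs_of_pos hθ]
    exact mul_le_mul hθM hZ (abs_nonneg _) (by positivity)
  have hm : ‖m‖ ≤ Real.sqrt (2 * Λ * M) := by
    simpa [abs_of_nonneg (norm_nonneg m)] using Real.abs_le_sqrt hm2
  have hinner : |⟪m, g⟫_ℝ| ≤ Real.sqrt (2 * Λ * M) * G :=
    (abs_real_inner_le_norm m g).trans (mul_le_mul hm hg (norm_nonneg _) (Real.sqrt_nonneg _))
  unfold collFlux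
  rw [abs_mul]
  exact mul_le_mul hfac hinner (abs_nonneg _) (by positivity)

/-! ## The analyticity band of the equation of state -/

/-- Inside the band where the excess free energy is real-analytic, the compressibility factor
`Z(η) = 1 + η f_ex′(η)` is continuous on `(0, η_e)` (the `deriv` is the derivative of the analytic
representative there). -/
theorem continuousOn_hsCompressibility {ηe : ℝ} {F : ℝ → ℝ} (hF : AnalyticOnNhd ℝ F (Ioo (-ηe) ηe))
    (hEq : EqOn hsExcessFreeEnergy F (Ico 0 ηe)) : ContinuousOn hsCompressibility (Ioo 0 ηe) := by
  have hderiv : EqOn (deriv hsExcessFreeEnergy) (deriv F) (Ioo 0 ηe) := fun η hη =>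
    ((hEq.mono Ioo_subset_Ico_self).eventuallyEq_of_mem (Ioo_mem_nhds hη.1 hη.2)).deriv_eq
  have hcont : ContinuousOn (deriv F) (Ioo 0 ηe) :=
    hF.deriv.continuousOn.mono fun η hη => ⟨by linarith [hη.1, hη.2], hη.2⟩
  unfold hsCompressibility
  exact continuousOn_const.add (continuousOn_id.mul (hcont.congr hderiv))

/-- A uniform bound for `|Z(η) − 1|` on a compact sub-band `[a, b] ⊂ (0, η_e)`. -/
theorem exists_bound_hsCompressibility_sub_one {ηe a b : ℝ} (hZ : ContinuousOn hsCompressibility (Ioo 0 ηe))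
    (ha : 0 < a) (hb : b < ηe) :
    ∃ CZ : ℝ, ∀ η ∈ Icc a b, |hsCompressibility η - 1| ≤ CZ := by
  have hc : ContinuousOn (fun η => hsCompressibility η - 1) (Icc a b) :=
    (hZ.mono fun η hη => ⟨ha.trans_le hη.1, hη.2.trans_lt hb⟩).sub continuousOn_const
  obtain ⟨C, hC⟩ := isCompact_Icc.exists_bound_of_continuousOn hc
  exact ⟨C, fun η hη => by simpa [Real.norm_eq_abs] using hC η hη⟩

/-! ## Continuity of the flux integrands in the point, on the good box -/

/-- Continuity of the temperature of a continuously varying non-vacuum coarse state. -/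
theorem continuous_thetaK_comp {α : Type*} [TopologicalSpace α] {ρ e : α → ℝ} {m : α → V3}
    (hρ : Continuous ρ) (hm : Continuous m) (he : Continuous e) (h0 : ∀ a, ρ a ≠ 0) :
    Continuous fun a => thetaK (ρ a) (m a) (e a) := by
  unfold thetaK
  refine continuous_const.mul ((he.div hρ h0).sub ((hm.norm.pow 2).div
    (continuous_const.mul (hρ.pow 2)) fun a => ?_))
  exact mul_ne_zero two_ne_zero (pow_ne_zero 2 (h0 a))

/-- Continuity of the kinetic flux of a continuously varying non-vacuum coarse state. -/
theorem continuous_kinFlux_comp {α : Type*} [TopologicalSpace α] {ρ e : α → ℝ} {m g : α → V3}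
    (hρ : Continuous ρ) (hm : Continuous m) (he : Continuous e) (hg : Continuous g)
    (h0 : ∀ a, ρ a ≠ 0) : Continuous fun a => kinFlux (ρ a) (m a) (e a) (g a) := by
  have hθ := continuous_thetaK_comp hρ hm he h0
  unfold kinFlux
  exact ((he.add (hρ.mul hθ)).div hρ h0).mul (hm.inner hg)

/-- Continuity of the collisional flux of a continuously varying coarse state whose reduced
density stays inside the analyticity band. -/
theorem continuous_collFlux_comp {α : Type*} [TopologicalSpace α] (σ : ℝ) {ηe : ℝ}
    (hZ : ContinuousOn hsCompressibility (Ioo 0 ηe)) {ρ e : α → ℝ} {m g : α → V3}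
    (hρ : Continuous ρ) (hm : Continuous m) (he : Continuous e) (hg : Continuous g)
    (h0 : ∀ a, ρ a ≠ 0) (hband : ∀ a, ρ a * σ ^ 3 ∈ Ioo 0 ηe) :
    Continuous fun a => collFlux σ (ρ a) (m a) (e a) (g a) := by
  have hθ := continuous_thetaK_comp hρ hm he h0
  have hZc : Continuous fun a => hsCompressibility (ρ a * σ ^ 3) :=
    hZ.comp_continuous (hρ.mul continuous_const) hband
  unfold collFlux hsPressure
  exact ((((hρ.mul hθ).mul hZc).sub (hρ.mul hθ)).div hρ h0).mul (hm.inner hg)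

/-- Continuity in the point of the coarse density of a fixed configuration. -/
theorem continuous_rhoK_point {φ : T3 → ℝ} (hφ : Continuous φ) (w : Cfg n) :
    Continuous fun x => rhoK φ w x := by
  rw [show (fun x => rhoK φ w x) = fun x => (n : ℝ)⁻¹ * ∑ i, φ (x - (w i).1) from
    funext fun x => rhoK_eq φ w x]
  exact continuous_const.mul (continuous_finsetSum _ fun i _ => hφ.comp (continuous_id.sub continuous_const))

/-- Continuity in the point of the coarse momentum of a fixed configuration. -/
theorem continuous_momK_point {φ : T3 → ℝ} (hφ : Continuous φ) (w : Cfg n) :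
    Continuous fun x => momK φ w x := by
  rw [show (fun x => momK φ w x) = fun x => (n : ℝ)⁻¹ • ∑ i, φ (x - (w i).1) • (w i).2 from
    funext fun x => momK_eq φ w x]
  have hsum : Continuous fun x : T3 => ∑ i, φ (x - (w i).1) • (w i).2 :=
    continuous_finsetSum _ fun i _ => (hφ.comp (continuous_id.sub continuous_const)).smul
      continuous_const
  exact hsum.const_smul ((n : ℝ)⁻¹)

/-- Continuity in the point of the coarse energy of a fixed configuration. -/
theorem continuous_enK_point {φ : T3 → ℝ} (hφ : Continuous φ) (w : Cfg n) :
    Continuous fun x => enK φ w x := by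
  rw [show (fun x => enK φ w x) = fun x => (n : ℝ)⁻¹ * ∑ i, φ (x - (w i).1) * (‖(w i).2‖ ^ 2 / 2) from
    funext fun x => enK_eq φ w x]
  exact continuous_const.mul (continuous_finsetSum _ fun i _ =>
    (hφ.comp (continuous_id.sub continuous_const)).mul continuous_const)

/-! ## Integrability and the split of the Euler energy flux on the good event -/

/-- A measurable real function bounded on `(0, t]` is integrable there. -/
theorem integrableOn_Ioc_of_bound {t : ℝ} {I : ℝ → ℝ} (hI : Measurable I) {B : ℝ}
    (hB : ∀ τ ∈ Ioc 0 t, |I τ| ≤ B) : IntegrableOn I (Ioc 0 t) := by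
  refine Integrable.mono' (integrable_const B) hI.aestronglyMeasurable ?_
  exact (ae_restrict_iff' measurableSet_Ioc).2 (Eventually.of_forall fun τ hτ => by
    simpa [Real.norm_eq_abs] using hB τ hτ)

/-- **The flux split on the good event.** For a reduced density `σ > 0`, an analyticity band
`η_e` of the equation of state with `Λσ³ < η_e`, a continuous kernel, a smooth test, a good orbit
of the flow and the GOOD event on `[0, t]`, the time-integrated hs-Euler energy flux of the coarse
fields is the sum of its kinetic and collisional parts as iterated Bochner integrals. -/
theorem flux_split {σ ηe : ℝ} (hσ : 0 < σ) {F : ℝ → ℝ} (hF : AnalyticOnNhd ℝ F (Ioo (-ηe) ηe))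
    (hEq : EqOn hsExcessFreeEnergy F (Ico 0 ηe)) {N : ℕ}
    (Φ : HardSphereFlow (Torus.geometry (Fin 3)) (hsDiameter σ N) (N + 1)) {z : Cfg (N + 1)}
    (hz : z ∈ Φ.good) {φ : T3 → ℝ} (hφ : Continuous φ) {χ : T3 → ℝ} (hχ : Torus.IsSmooth χ)
    {lam Λ M t : ℝ} (hlam : 0 < lam) (hΛ : Λ * σ ^ 3 < ηe)
    (hgood : GoodEvt φ lam Λ M (fun τ => Φ.flow τ z) t) :
    ∫ τ in Ioc 0 t, ∫ x, enFlux σ (rhoK φ (Φ.flow τ z) x) (momK φ (Φ.flow τ z) x)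
        (enK φ (Φ.flow τ z) x) (Torus.gradient χ x) =
      (∫ τ in Ioc 0 t, ∫ x, kinFlux (rhoK φ (Φ.flow τ z) x) (momK φ (Φ.flow τ z) x)
        (enK φ (Φ.flow τ z) x) (Torus.gradient χ x)) +
      ∫ τ in Ioc 0 t, ∫ x, collFlux σ (rhoK φ (Φ.flow τ z) x) (momK φ (Φ.flow τ z) x)
        (enK φ (Φ.flow τ z) x) (Torus.gradient χ x) := by
  -- the test field and its sup bound
  have hg : Continuous (Torus.gradient χ) := hχ.gradient.continuous
  obtain ⟨G, hG⟩ := isCompact_univ.exists_bound_of_continuousOn hg.continuousOn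
  have hG' : ∀ x, ‖Torus.gradient χ x‖ ≤ G := fun x => hG x (mem_univ x)
  -- the band
  have hZ := continuousOn_hsCompressibility hF hEq
  have hσ3 : 0 < σ ^ 3 := pow_pos hσ 3
  obtain ⟨CZ, hCZ⟩ := exists_bound_hsCompressibility_sub_one hZ (mul_pos hlam hσ3) hΛ
  -- pointwise facts on the good event
  have hbox : ∀ τ ∈ Icc 0 t, ∀ x, lam ≤ rhoK φ (Φ.flow τ z) x ∧ rhoK φ (Φ.flow τ z) x ≤ Λ ∧
      enK φ (Φ.flow τ z) x ≤ M ∧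
      lam ≤ thetaK (rhoK φ (Φ.flow τ z) x) (momK φ (Φ.flow τ z) x) (enK φ (Φ.flow τ z) x) :=
    hgood
  have hne : ∀ τ ∈ Icc 0 t, ∀ x, rhoK φ (Φ.flow τ z) x ≠ 0 := fun τ hτ x =>
    (hlam.trans_le (hbox τ hτ x).1).ne'
  have hband : ∀ τ ∈ Icc 0 t, ∀ x, rhoK φ (Φ.flow τ z) x * σ ^ 3 ∈ Ioo 0 ηe := fun τ hτ x =>
    ⟨mul_pos (hlam.trans_le (hbox τ hτ x).1) hσ3,
      (mul_le_mul_of_nonneg_right (hbox τ hτ x).2.1 hσ3.le).trans_lt hΛ⟩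
  have hZx : ∀ τ ∈ Icc 0 t, ∀ x, |hsCompressibility (rhoK φ (Φ.flow τ z) x * σ ^ 3) - 1| ≤ CZ :=
    fun τ hτ x => hCZ _ ⟨mul_le_mul_of_nonneg_right (hbox τ hτ x).1 hσ3.le,
      mul_le_mul_of_nonneg_right (hbox τ hτ x).2.1 hσ3.le⟩
  -- x-integrability at each good time
  have hintK : ∀ τ ∈ Icc 0 t, Integrable fun x => kinFlux (rhoK φ (Φ.flow τ z) x)
      (momK φ (Φ.flow τ z) x) (enK φ (Φ.flow τ z) x) (Torus.gradient χ x) := fun τ hτ => by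
    exact integrable_of_continuous_T3 (continuous_kinFlux_comp (continuous_rhoK_point hφ _)
      (continuous_momK_point hφ _) (continuous_enK_point hφ _) hg (hne τ hτ))
  have hintC : ∀ τ ∈ Icc 0 t, Integrable fun x => collFlux σ (rhoK φ (Φ.flow τ z) x)
      (momK φ (Φ.flow τ z) x) (enK φ (Φ.flow τ z) x) (Torus.gradient χ x) := fun τ hτ => by
    exact integrable_of_continuous_T3 (continuous_collFlux_comp σ hZ (continuous_rhoK_point hφ _)
      (continuous_momK_point hφ _) (continuous_enK_point hφ _) hg (hne τ hτ) (hband τ hτ))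
  -- bounds on the x-integrals at good times
  have hBK : ∀ τ ∈ Icc 0 t, |∫ x, kinFlux (rhoK φ (Φ.flow τ z) x) (momK φ (Φ.flow τ z) x)
      (enK φ (Φ.flow τ z) x) (Torus.gradient χ x)| ≤ 2 * M / lam * (Real.sqrt (2 * Λ * M) * G) :=
    fun τ hτ => by
    have h := norm_integral_le_of_norm_le_const (μ := (volume : Measure T3))
      (f := fun x => kinFlux (rhoK φ (Φ.flow τ z) x) (momK φ (Φ.flow τ z) x)
        (enK φ (Φ.flow τ z) x) (Torus.gradient χ x))
      (C := 2 * M / lam * (Real.sqrt (2 * Λ * M) * G)) (Eventually.of_forall fun x => by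
        rw [Real.norm_eq_abs]
        obtain ⟨b1, b2, b3, b4⟩ := hbox τ hτ x
        exact abs_kinFlux_le hlam b1 b2 b3 b4 (hG' x))
    simpa [Real.norm_eq_abs] using h
  have hBC : ∀ τ ∈ Icc 0 t, |∫ x, collFlux σ (rhoK φ (Φ.flow τ z) x) (momK φ (Φ.flow τ z) x)
      (enK φ (Φ.flow τ z) x) (Torus.gradient χ x)| ≤
      M / lam * CZ * (Real.sqrt (2 * Λ * M) * G) := fun τ hτ => by
    have h := norm_integral_le_of_norm_le_const (μ := (volume : Measure T3))
      (f := fun x => collFlux σ (rhoK φ (Φ.flow τ z) x) (momK φ (Φ.flow τ z) x)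
        (enK φ (Φ.flow τ z) x) (Torus.gradient χ x))
      (C := M / lam * CZ * (Real.sqrt (2 * Λ * M) * G)) (Eventually.of_forall fun x => by
        rw [Real.norm_eq_abs]
        obtain ⟨b1, b2, b3, b4⟩ := hbox τ hτ x
        exact abs_collFlux_le hlam b1 b2 b3 b4 (hG' x) (hZx τ hτ x))
    simpa [Real.norm_eq_abs] using h
  -- measurability in time along the good orbit (joint measurability of the flow)
  have hmK : Measurable fun τ => ∫ x, kinFlux (rhoK φ (Φ.flow τ z) x) (momK φ (Φ.flow τ z) x)
      (enK φ (Φ.flow τ z) x) (Torus.gradient χ x) :=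
    (measurable_integral_right (measurable_kinIntegrand hφ hg)).comp (measurable_orbit Φ hz)
  have hmC : Measurable fun τ => ∫ x, collFlux σ (rhoK φ (Φ.flow τ z) x) (momK φ (Φ.flow τ z) x)
      (enK φ (Φ.flow τ z) x) (Torus.gradient χ x) :=
    (measurable_integral_right (measurable_collIntegrand σ hφ hg)).comp (measurable_orbit Φ hz)
  -- τ-integrability on (0, t]
  have hIK := integrableOn_Ioc_of_bound hmK fun τ hτ => hBK τ (Ioc_subset_Icc_self hτ)
  have hIC := integrableOn_Ioc_of_bound hmC fun τ hτ => hBC τ (Ioc_subset_Icc_self hτ)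
  -- the split
  rw [← integral_add hIK hIC]
  refine setIntegral_congr_fun measurableSet_Ioc fun τ hτ => ?_
  rw [← integral_add (hintK τ (Ioc_subset_Icc_self hτ)) (hintC τ (Ioc_subset_Icc_self hτ))]
  exact integral_congr_ae (Eventually.of_forall fun x => enFlux_eq_kinFlux_add_collFlux _ _ _ _ _)

/-! ## The exact energy transport identity (Literature weak energy balance law) -/

/-- **Exact energy transport along good orbits.** For a smooth test `χ`, a good datum `z` and
`t ≥ 0`, the increment of the empirical energy field is `(N+1)⁻¹ ∫_{(0,t]}` of the streaming energy
flux plus `(N+1)⁻¹ ×` the collisional energy transfer over `(0, t]`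
(`HardSphereFlow.energyObservable_sub_eq_torus`, normalised; interval integral = integral over
`Ioc 0 t`; `Φ_0 z = z` on the good set). -/
theorem transport_identity {σ : ℝ} {N : ℕ}
    (Φ : HardSphereFlow (Torus.geometry (Fin 3)) (hsDiameter σ N) (N + 1)) {z : Cfg (N + 1)}
    (hz : z ∈ Φ.good) {χ : T3 → ℝ} (hχ : Torus.IsSmooth χ) {t : ℝ} (ht : 0 ≤ t) :
    empiricalEnergyField (Φ.flow t z) χ - empiricalEnergyField (Φ.flow 0 z) χ =
      ((N + 1 : ℕ) : ℝ)⁻¹ * (∫ τ in Ioc 0 t, energyStreaming χ (Φ.flow τ z)) +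
        ((N + 1 : ℕ) : ℝ)⁻¹ * Φ.energyTransfer χ z t := by
  have hχ1 : Literature.Analysis.FunctionSpaces.Torus.IsContDiff 1 χ :=
    hχ.isContDiff (by exact_mod_cast le_top)
  obtain ⟨-, hbal⟩ := Φ.energyObservable_sub_eq_torus hχ1 hz ht
  rw [intervalIntegral.integral_of_le ht] at hbal
  have hE : ∀ w : Cfg (N + 1), empiricalEnergyField w χ =
      ((N + 1 : ℕ) : ℝ)⁻¹ * energyObservable χ w := fun w => by
    rw [empiricalEnergyField_eq_sum]
    rfl
  rw [hE, hE, Φ.flow_zero z hz, ← mul_sub, hbal, mul_add]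

/-! ## Probability bookkeeping: union bound inside the frame -/

/-- The local Gibbs laws are carried by the flow's good set (they are absolutely continuous with
respect to the Liouville measure). -/
theorem localGibbsLaw_compl_good {σ : ℝ} (a₀ θ₀ : T3 → ℝ) (u₀ : T3 → V3) (N : ℕ)
    (Φ : HardSphereFlow (Torus.geometry (Fin 3)) (hsDiameter σ N) (N + 1)) :
    localGibbsLaw σ a₀ u₀ θ₀ N Φ Φ.goodᶜ = 0 := by
  rw [localGibbsLaw_eq]
  exact localGibbsMeasure_absolutelyContinuous σ a₀ u₀ θ₀ N Φ Φ.measure_compl_good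

/-- Measure of a set covered by two sets and a null set. -/
theorem measure_le_of_subset_union_null {α : Type*} [MeasurableSpace α] (μ : Measure α)
    {A B C Z : Set α} (hZ : μ Z = 0) (h : A ⊆ B ∪ C ∪ Z) : μ A ≤ μ B + μ C :=
  (measure_mono h).trans ((measure_union_le _ _).trans (by
    rw [hZ, add_zero]
    exact measure_union_le _ _))

/-- Squeeze: a sequence in `ℝ≥0∞` dominated by the sum of two null sequences is null. -/
theorem tendsto_zero_of_le_add {f g h : ℕ → ℝ≥0∞} (hg : Tendsto g atTop (𝓝 0))
    (hh : Tendsto h atTop (𝓝 0)) (hle : ∀ N, f N ≤ g N + h N) : Tendsto f atTop (𝓝 0) := by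
  have hs : Tendsto (fun N => g N + h N) atTop (𝓝 0) := by simpa using hg.add hh
  exact tendsto_of_tendsto_of_tendsto_of_le_of_le tendsto_const_nhds hs (fun _ => bot_le) hle

/-- **Union bound inside the common frame.** If two deviation functionals satisfy the frame and,
on the flow's good set and the GOOD event, a third is pointwise dominated by the sum of their
absolute values whenever `Λσ³` lies inside a band `η_e > 0`, then the third satisfies the frame
(packing cap `min(η₁, η₂, η_e/2)`, `σ₀ = min`, tolerance `κ/2` twice, resolution `r = min`). -/
theorem frame_of_two {D D₁ D₂ : Dev} {ηe : ℝ} (hηe : 0 < ηe) (hD₁ : Frame D₁) (hD₂ : Frame D₂)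
    (H : ∀ σ : ℝ, 0 < σ → ∀ (Φ : Flows σ) (t : ℝ), 0 ≤ t → ∀ χ : T3 → ℝ, Torus.IsSmooth χ →
      ∀ lam Λ M : ℝ, 0 < lam → Λ * σ ^ 3 < ηe → ∀ φ : T3 → ℝ, Continuous φ → ∀ N : ℕ,
      ∀ z ∈ (Φ N).good, GoodEvt φ lam Λ M (fun τ => (Φ N).flow τ z) t →
      |D σ Φ t χ lam Λ M φ N z| ≤ |D₁ σ Φ t χ lam Λ M φ N z| + |D₂ σ Φ t χ lam Λ M φ N z|) :
    Frame D := by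
  obtain ⟨η₁, hη₁, h₁⟩ := hD₁
  obtain ⟨η₂, hη₂, h₂⟩ := hD₂
  refine ⟨min (min η₁ η₂) (ηe / 2), lt_min (lt_min hη₁ hη₂) (half_pos hηe), ?_⟩
  intro a₀ θ₀ u₀ ha hθ hu ha0 hθ0
  obtain ⟨σ₁, hσ₁, h₁⟩ := h₁ a₀ θ₀ u₀ ha hθ hu ha0 hθ0
  obtain ⟨σ₂, hσ₂, h₂⟩ := h₂ a₀ θ₀ u₀ ha hθ hu ha0 hθ0
  refine ⟨min σ₁ σ₂, lt_min hσ₁ hσ₂, ?_⟩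
  intro σ hσ hσlt T ρ θ u hsol Φ h0 t ht χ hχ lam Λ M hlam hΛ κ hκ
  have hΛ₁ : Λ * σ ^ 3 ≤ η₁ := hΛ.trans ((min_le_left _ _).trans (min_le_left _ _))
  have hΛ₂ : Λ * σ ^ 3 ≤ η₂ := hΛ.trans ((min_le_left _ _).trans (min_le_right _ _))
  have hΛe : Λ * σ ^ 3 < ηe := (hΛ.trans (min_le_right _ _)).trans_lt (by linarith)
  obtain ⟨r₁, hr₁, h₁⟩ := h₁ σ hσ (hσlt.trans_le (min_le_left _ _)) T ρ θ u hsol Φ h0 t ht χ hχ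
    lam Λ M hlam hΛ₁ (κ / 2) (half_pos hκ)
  obtain ⟨r₂, hr₂, h₂⟩ := h₂ σ hσ (hσlt.trans_le (min_le_right _ _)) T ρ θ u hsol Φ h0 t ht χ hχ
    lam Λ M hlam hΛ₂ (κ / 2) (half_pos hκ)
  refine ⟨min r₁ r₂, lt_min hr₁ hr₂, ?_⟩
  intro φ hφ hφ0 hφ1 hφr
  have T₁ := h₁ φ hφ hφ0 hφ1 fun y hy => hφr y ((min_le_left _ _).trans hy)
  have T₂ := h₂ φ hφ hφ0 hφ1 fun y hy => hφr y ((min_le_right _ _).trans hy)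
  refine tendsto_zero_of_le_add T₁ T₂ fun N => ?_
  refine measure_le_of_subset_union_null _ (localGibbsLaw_compl_good a₀ θ₀ u₀ N (Φ N)) ?_
  intro z hz
  by_cases hzg : z ∈ (Φ N).good
  · left
    obtain ⟨hG, hκz⟩ := hz
    have hH := H σ hσ Φ t ht.1 χ hχ lam Λ M hlam hΛe φ hφ N z hzg hG
    by_contra hnot
    simp only [mem_union, mem_setOf_eq, not_or, not_and, not_lt] at hnot
    have hb₁ := hnot.1 hG
    have hb₂ := hnot.2 hG
    linarith
  · right
    exact hzg

/-! ## The assembly -/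

/-- **The decomposition theorem (structured form).** Kinetic energy-flux locality and
collisional energy-transfer locality imply energy-flux locality: inside the analyticity band of the
equation of state (the PROVED support `HsEosLowDensity`), on the flow's good set and the GOOD event,
the crux's deviation is EXACTLY the sum of the two channel deviations (the exact transport identity
`transport_identity` and the flux split `flux_split`), and `frame_of_two` is the union bound. -/
theorem frame_devE_of (hK : Frame devK) (hC : Frame devC) : Frame devE := by
  obtain ⟨ηe, hηe, F, hF, hEq, -, -, -⟩ :=
    Summit.AtomisticToContinuum.HydrodynamicLimit.Theses.InvariantGibbsBookkeeping.HsEosLowDensity_holds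
  refine frame_of_two hηe hK hC ?_
  intro σ hσ Φ t ht χ hχ lam Λ M hlam hΛe φ hφ N z hz hgood
  have hsplit := flux_split hσ hF hEq (Φ N) hz hφ hχ hlam hΛe hgood
  have htr := transport_identity (Φ N) hz hχ ht
  have hsum : devE σ Φ t χ lam Λ M φ N z =
      devK σ Φ t χ lam Λ M φ N z + devC σ Φ t χ lam Λ M φ N z := by
    simp only [devE, devK, devC]
    rw [htr, hsplit]
    ring
  rw [hsum]
  exact abs_add_le _ _

/-- **`EnergyFluxLocality` FROM ITS TWO PIECES** (the line's kernel-checked composition; the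
hypotheses are the two stub statements BY NAME — each verbatim a child statement of the split —
and the conclusion is the route decl BY NAME):
`KineticEnergyFluxLocality → CollisionalEnergyTransferLocality → EnergyFluxLocality`. -/
theorem EnergyFluxLocality_of (hK : stub_kineticEnergyFluxLocality)
    (hC : stub_collisionalEnergyTransferLocality) :
    Summit.AtomisticToContinuum.HydrodynamicLimit.Theses.InvariantGibbsBookkeeping.EnergyFluxLocality :=
  frame_devE_iff.1 (frame_devE_of (frame_devK_iff.2 hK) (frame_devC_iff.2 hC))

end

end Summit.AtomisticToContinuum.HydrodynamicLimit.Cruxes.EnergyFluxLocality.KineticCollisionalSplit
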